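import Mathlib
import Summits.Ventures.HodgeRepro2.BallQuotientCompactConstant

/-!
# `Γ\𝔹²` is a metrizable, σ-compact, path-connected surface

Kernel annex of the blind cell `pub-hodge-repro2` (seat p2), Tier-3 hypothesis shapes of
`Hypothesis.lean`.  Point-set corollaries of the manifold structure of
`BallQuotientComplexManifold.lean` on `Γ\𝔹²` (torsion-free `Γ ⊆ Γ_N`, `H` definite away from
`τ₁`): σ-compactness, metrizability (Mathlib `Manifold.metrizableSpace` for the underlying REAL
charted space), local path-connectedness (`ChartedSpace.locallyPathConnectedSpace`) and
path-connectedness (from `connectedSpace_ballQuotient`) — the topological half of «`Γ\𝔹²` is a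
connected complex surface», complementing the Hausdorff / second-countable / locally compact
statements of `BallQuotientHausdorff.lean`.
-/

namespace Summit.Ventures.HodgeRepro2.ShimuraData

open scoped Manifold

variable {K : Type*} [Field K] [NumberField K] [NumberField.IsCMField K]
  {τ₁ : K →+* ℂ} {H : Matrix (Fin 3) (Fin 3) K} {Q : Matrix (Fin 3) (Fin 3) ℂ}
  (hQ : IsFrame K τ₁ H Q) (S : Subgroup (GL (Fin 3) K))
  (hS : (S : Set (GL (Fin 3) K)) ⊆ (unitaryGroup K H : Set (GL (Fin 3) K)))

/-- `Γ\𝔹²` is σ-compact (locally compact and second countable). -/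
theorem sigmaCompactSpace_ballQuotient : SigmaCompactSpace (ballQuotient hQ S hS) :=
  haveI := locallyCompactSpace_ballQuotient hQ S hS
  haveI := secondCountableTopology_ballQuotient hQ S hS
  inferInstance

/-- `Γ\𝔹²` is locally path-connected, for the atlas pushed forward from the ball. -/
theorem locallyPathConnectedSpace_ballQuotient (hf : IsLocalHomeomorph (ballQuotient.mk hQ S hS)) :
    LocallyPathConnectedSpace (ballQuotient hQ S hS) :=
  letI := ballQuotientChartedSpace hQ S hS hf
  ChartedSpace.locallyPathConnectedSpace (Fin 2 → ℂ) (ballQuotient hQ S hS)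

/-- `Γ\𝔹²` is path-connected (connected and locally path-connected). -/
theorem pathConnectedSpace_ballQuotient (hf : IsLocalHomeomorph (ballQuotient.mk hQ S hS)) :
    PathConnectedSpace (ballQuotient hQ S hS) :=
  haveI := locallyPathConnectedSpace_ballQuotient hQ S hS hf
  pathConnectedSpace_iff_connectedSpace.2 (connectedSpace_ballQuotient hQ S hS)

/-- `Γ\𝔹²` is metrizable whenever it is Hausdorff and the quotient map is a local homeomorphism
(a σ-compact Hausdorff manifold over the real vector space `ℂ²`). -/
theorem metrizableSpace_ballQuotient (hf : IsLocalHomeomorph (ballQuotient.mk hQ S hS))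
    [T2Space (ballQuotient hQ S hS)] : TopologicalSpace.MetrizableSpace (ballQuotient hQ S hS) :=
  letI := ballQuotientChartedSpace hQ S hS hf
  haveI := sigmaCompactSpace_ballQuotient hQ S hS
  Manifold.metrizableSpace 𝓘(ℝ, Fin 2 → ℂ) (ballQuotient hQ S hS)

section instantiation

variable {hQ S}

/-- **`Γ\𝔹²` is a metrizable, σ-compact, path-connected complex surface for every torsion-free
`Γ ⊆ Γ_N`** (`H` definite away from `τ₁`, `𝔪` a lattice): the topological half of
«`Y_Γ = Γ\𝔹²` is a connected smooth surface». -/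
theorem metrizableSpace_and_pathConnectedSpace_ballQuotient_of_isTorsionFreeSet
    (hH : IsHermitianForm K H)
    (hdef : ∀ τ : K →+* ℂ, NumberField.InfinitePlace.mk τ ≠ NumberField.InfinitePlace.mk τ₁ →
      IsDefiniteAt K τ H)
    {𝔪 : Submodule ℤ (Fin 3 → K)} (h𝔪 : IsLattice K 𝔪) {N : ℕ}
    (hS : ↑S ⊆ shimuraLevel K H 𝔪 N) (htf : IsTorsionFreeSet K (S : Set (GL (Fin 3) K))) :
    TopologicalSpace.MetrizableSpace
        (ballQuotient hQ S (subset_unitaryGroup_of_subset_shimuraLevel hS)) ∧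
      PathConnectedSpace (ballQuotient hQ S (subset_unitaryGroup_of_subset_shimuraLevel hS)) := by
  haveI := t2Space_ballQuotient hH hdef hQ h𝔪 hS
  have hf := (isCoveringMap_ballQuotient_mk_of_isTorsionFreeSet hH hdef hQ h𝔪 hS htf).isLocalHomeomorph
  exact ⟨metrizableSpace_ballQuotient hQ S _ hf, pathConnectedSpace_ballQuotient hQ S _ hf⟩

end instantiation

end Summit.Ventures.HodgeRepro2.ShimuraData
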